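import Summits.KontsevichZagierPeriods.KontsevichZagierPeriods.Theorems.AbelContractionRealHyperellipticSectorStubEulerKit

/-!
# Route AbelContraction — `RealHyperellipticSector` (crux stmt-KontsevichZagierPeriods-12475): Euler's substitutions for `deg q = 2`

Helper file of the line `Lines/birth.lean` (stub `stub_euler`, `--supports` the crux): the two
genuine quadratic cases of the genus-`0` rationalisation of an arc `[S, (A + B√q)/D]`
(`S ⊆ {q > 0}` an open interval, `A B D ∈ ℚ[X]`) inside dimension one, each ONE move of rule (2)
to a real-algebraic rational arc (`Euler.exists_algArc_of_subst` of the kit):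

* `Euler.euler_twoRoots` — `q = a (x − e)(x − e')` with two simple real (algebraic) roots:
  Euler's third substitution `t = √q/(x − e)`, `t² = a (x − e')/(x − e)`,
  `x = (a e' − t² e)/(a − t²)`, `√q = t (x − e)`, `dt/dx = a (e' − e)/(2 √q (x − e)) ≠ 0`; the side
  of `e` on which the interval `S` lies enters as a sign `σ = ±1` (`Euler.exists_sign_of_notMem`,
  `|x − e| = σ (x − e)` on `S`);
* `Euler.euler_noRoot` (registered sub-goal) — `q = a x² + b x + c` with `a > 0`, `b² < 4ac`:
  Euler's first substitution `t = √q + √a x`, strictly increasing since `(2ax + b)² < 4aq`,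
  `x = (t² − c)/(b + 2√a t)`, `√q = t − √a x`.

In both cases the inverse `ψ` and the pushed-forward integrand `(A + B√q)/(D |dt/dx|)`, read in
`t`, are `K`-rational (`K` the real algebraic numbers: `√a`, `e`, `e'`, `σ` are algebraic), which is
what `algArcs` asks.

References: M. Kontsevich, D. Zagier, *Periods* (2001), §1.2 rule (2) [KontsevichZagier2001];
L. Euler, *Institutiones calculi integralis* I (1768), §§ 88–99 (Euler's substitutions; folklore,
any calculus text). No definitions are introduced.
-/

noncomputable section

open Set MeasureTheory
open scoped Polynomial
open Literature.ModelTheory.ExponentialFields (IsSemialgebraic)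
open Literature.NumberTheory.Transcendental Literature.NumberTheory.Transcendental.KZ

namespace Summit.KontsevichZagierPeriods.AbelContraction.RealHyperellipticSector

namespace Euler

/-! ## Euler's substitution for two simple real roots: `t = √q/(x − e)` -/

/-- An order-connected set missing a point lies on one side of it; the side is recorded as a sign
`σ = ±1` with `|x − e| = σ (x − e)` on the set. [folklore] -/
theorem exists_sign_of_notMem {S : Set ℝ} (hSo : S.OrdConnected) {e : ℝ} (he : e ∉ S) :
    ∃ σ : ℝ, (σ = 1 ∨ σ = -1) ∧ ∀ x ∈ S, |x - e| = σ * (x - e) := by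
  by_cases h : ∀ x ∈ S, e < x
  · exact ⟨1, Or.inl rfl, fun x hx => by rw [one_mul, abs_of_pos (sub_pos.mpr (h x hx))]⟩
  · push Not at h
    obtain ⟨x, hx, hxe⟩ := h
    have hxe' : x < e := lt_of_le_of_ne hxe fun h => he (h ▸ hx)
    refine ⟨-1, Or.inr rfl, fun y hy => ?_⟩
    have hye : y < e := by
      by_contra hcon
      exact he (hSo.out hx hy ⟨hxe, not_lt.mp hcon⟩)
    rw [abs_of_neg (sub_neg.mpr hye)]
    ring

/-- **Euler's (third) substitution, two simple real roots.** For an arc `[S, (A + B√q)/D]` with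
`q = a (x − e)(x − e')`, `a ≠ 0`, `e ≠ e'` real algebraic, the substitution `t = √(q(x))/(x − e)`
(so `t² = a (x − e')/(x − e)`, inverse `x = (a e' − t² e)/(a − t²)`, `√q = t (x − e)`,
`dt/dx = a (e' − e)/(2 √q (x − e))`) is one rule-(2) move to a real-algebraic rational arc.
[cite: KontsevichZagier2001, §1.2 rule (2)] -/
theorem euler_twoRoots (r : IntegralRep 1) (A B D : ℚ[X]) {S : Set ℝ} (hS : IsOpen S)
    (hSo : S.OrdConnected) (hdom : r.domain = {p | p 0 ∈ S}) (q : ℝ → ℝ) {a e e' : ℝ}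
    (ha : IsAlgebraic ℚ a) (he : IsAlgebraic ℚ e) (he' : IsAlgebraic ℚ e') (ha0 : a ≠ 0)
    (hee' : e ≠ e') (hq : ∀ x, q x = a * (x - e) * (x - e'))
    (hpos : ∀ x ∈ S, 0 < q x) (hD : ∀ x ∈ S, (Polynomial.aeval x D : ℝ) ≠ 0)
    (hint : ∀ p ∈ r.domain, r.integrand p = (Polynomial.aeval (p 0) A +
      Polynomial.aeval (p 0) B * √(q (p 0))) / Polynomial.aeval (p 0) D) :
    ∃ x' ∈ algArcs, of r - x' ∈ relationsLE 1 := by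
  have hmem : ∀ p, p ∈ r.domain ↔ p 0 ∈ S := fun p => by rw [hdom]; rfl
  have hσ := r.isSemialgebraic_domain
  have hsq : ∀ x ∈ S, 0 < √(q x) := fun x hx => Real.sqrt_pos.mpr (hpos x hx)
  have hxe : ∀ x ∈ S, x - e ≠ 0 := fun x hx h => by
    have := hpos x hx
    rw [hq, h] at this
    simp at this
  have heS : e ∉ S := fun h => hxe e h (sub_self e)
  obtain ⟨sgn, hsgn, habs⟩ := exists_sign_of_notMem hSo heS
  have hsgnA : IsAlgebraic ℚ sgn := by
    rcases hsgn with rfl | rfl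
    exacts [isAlgebraic_one, isAlgebraic_one.neg]
  have hee'0 : e' - e ≠ 0 := sub_ne_zero.mpr (Ne.symm hee')
  -- semialgebraicity of `φ = √q/(x − e)` and `φ' = a (e' − e)/(2 √q (x − e))` on the slab
  have hx0 : IsSemialgebraicFunOn ℚ r.domain (fun p : Fin 1 → ℝ => p 0) := by
    simpa using isSemialgebraicFunOn_aeval hσ (MvPolynomial.X 0 : MvPolynomial (Fin 1) ℚ)
  have h2A : IsAlgebraic ℚ (2 : ℝ) := by simpa using isAlgebraic_nat (R := ℚ) (A := ℝ) 2
  have habsA : ∀ {y : ℝ}, IsAlgebraic ℚ y → IsAlgebraic ℚ |y| := fun {y} hy => by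
    rcases abs_choice y with h | h <;> rw [h]
    exacts [hy, hy.neg]
  have hxesa : IsSemialgebraicFunOn ℚ r.domain (fun p => p 0 - e) :=
    hx0.fun_sub (isSemialgebraicFunOn_const_of_isAlgebraic hσ he)
  have hqsa : IsSemialgebraicFunOn ℚ r.domain (fun p => q (p 0)) :=
    ((((isSemialgebraicFunOn_const_of_isAlgebraic hσ ha).fun_mul hxesa)).fun_mul
      (hx0.fun_sub (isSemialgebraicFunOn_const_of_isAlgebraic hσ he'))).congr
      fun p _ => (hq (p 0)).symm
  have hφ : IsSemialgebraicFunOn ℚ r.domain (fun p => √(q (p 0)) / (p 0 - e)) :=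
    hqsa.fun_sqrt.div hxesa fun p hp => hxe _ ((hmem p).1 hp)
  have hφ' : IsSemialgebraicFunOn ℚ r.domain
      (fun p => a * (e' - e) / (2 * √(q (p 0)) * (p 0 - e))) :=
    (isSemialgebraicFunOn_const_of_isAlgebraic hσ (ha.mul (he'.sub he))).div
      (((isSemialgebraicFunOn_const_ofNat hσ 2).fun_mul hqsa.fun_sqrt).fun_mul hxesa)
      fun p hp => mul_ne_zero (mul_ne_zero two_ne_zero (hsq _ ((hmem p).1 hp)).ne')
        (hxe _ ((hmem p).1 hp))
  -- the derivative
  have hq' : ∀ x, HasDerivAt q (a * 1 * (x - e') + a * (x - e) * 1) x := fun x => by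
    have eq : q = fun y => a * (y - e) * (y - e') := funext hq
    rw [eq]
    exact (((hasDerivAt_id' x).sub_const e).const_mul a).mul ((hasDerivAt_id' x).sub_const e')
  have hder : ∀ x ∈ S, HasDerivAt (fun y => √(q y) / (y - e))
      (a * (e' - e) / (2 * √(q x) * (x - e))) x := fun x hx => by
    have h1 := hsq x hx
    have h2 := hxe x hx
    have hs2 : √(q x) * √(q x) = a * (x - e) * (x - e') := by
      rw [Real.mul_self_sqrt (hpos x hx).le, hq]
    refine (((hq' x).sqrt (hpos x hx).ne').div ((hasDerivAt_id' x).sub_const e) h2).congr_deriv ?_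
    have e1 : (a * 1 * (x - e') + a * (x - e) * 1) / (2 * √(q x)) * (x - e) - √(q x) * 1 =
        a * (x - e) * (e' - e) / (2 * √(q x)) := by
      field_simp
      linear_combination (-2) * hs2
    rw [e1]
    field_simp
  have hne : ∀ x ∈ S, a * (e' - e) / (2 * √(q x) * (x - e)) ≠ 0 := fun x hx =>
    div_ne_zero (mul_ne_zero ha0 hee'0)
      (mul_ne_zero (mul_ne_zero two_ne_zero (hsq x hx).ne') (hxe x hx))
  -- the inverse `ψ t = (a e' − t² e)/(a − t²)`
  have hden : ∀ x ∈ S, a - (√(q x) / (x - e)) ^ 2 ≠ 0 := fun x hx h => by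
    rw [div_pow, Real.sq_sqrt (hpos x hx).le, hq, sub_eq_zero,
      eq_div_iff (pow_ne_zero 2 (hxe x hx))] at h
    have : a * (x - e) * (e' - e) = 0 := by linear_combination h
    simp only [mul_eq_zero] at this
    rcases this with (h' | h') | h'
    exacts [ha0 h', hxe x hx h', hee'0 h']
  have hψφ : ∀ x ∈ S,
      (a * e' - (√(q x) / (x - e)) ^ 2 * e) / (a - (√(q x) / (x - e)) ^ 2) = x := fun x hx => by
    have h3 := hxe x hx
    rw [div_eq_iff (hden x hx), div_pow, Real.sq_sqrt (hpos x hx).le, hq]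
    field_simp
    ring
  have hψ : ∃ P Q : (algebraicClosure ℚ ℝ)[X], ∀ t ∈ (fun y => √(q y) / (y - e)) '' S,
      (Polynomial.aeval t Q : ℝ) ≠ 0 ∧
      (fun t : ℝ => (a * e' - t ^ 2 * e) / (a - t ^ 2)) t =
        (Polynomial.aeval t P : ℝ) / (Polynomial.aeval t Q : ℝ) := by
    refine krat_div (krat_sub (krat_const _ (ha.mul he')) (krat_mul (krat_pow (krat_id _) 2)
      (krat_const _ he))) (krat_sub (krat_const _ ha) (krat_pow (krat_id _) 2)) ?_
    rintro _ ⟨x, hx, rfl⟩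
    exact hden x hx
  -- the pushed-forward integrand
  have hDT : ∀ t ∈ (fun y => √(q y) / (y - e)) '' S,
      (Polynomial.aeval ((a * e' - t ^ 2 * e) / (a - t ^ 2)) D : ℝ) ≠ 0 := by
    rintro _ ⟨x, hx, rfl⟩
    beta_reduce
    rw [hψφ x hx]
    exact hD x hx
  have hF : ∃ P Q : (algebraicClosure ℚ ℝ)[X], ∀ t ∈ (fun y => √(q y) / (y - e)) '' S,
      (Polynomial.aeval t Q : ℝ) ≠ 0 ∧
      (fun t : ℝ => (Polynomial.aeval ((a * e' - t ^ 2 * e) / (a - t ^ 2)) A +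
          Polynomial.aeval ((a * e' - t ^ 2 * e) / (a - t ^ 2)) B *
            (t * ((a * e' - t ^ 2 * e) / (a - t ^ 2) - e))) /
          Polynomial.aeval ((a * e' - t ^ 2 * e) / (a - t ^ 2)) D *
          (2 * sgn * t * ((a * e' - t ^ 2 * e) / (a - t ^ 2) - e) ^ 2 / (|a| * |e' - e|))) t =
        (Polynomial.aeval t P : ℝ) / (Polynomial.aeval t Q : ℝ) :=
    krat_mul (krat_div (krat_add (krat_aeval A hψ) (krat_mul (krat_aeval B hψ)
      (krat_mul (krat_id _) (krat_sub hψ (krat_const _ he))))) (krat_aeval D hψ) hDT)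
      (krat_div (krat_mul (krat_mul (krat_mul (krat_const _ h2A)
        (krat_const _ hsgnA)) (krat_id _)) (krat_pow (krat_sub hψ (krat_const _ he)) 2))
        (krat_const _ ((habsA ha).mul (habsA (he'.sub he))))
        fun _ _ => mul_ne_zero (abs_ne_zero.mpr ha0) (abs_ne_zero.mpr hee'0))
  refine exists_algArc_of_subst r S hS hSo hdom (fun y => √(q y) / (y - e))
    (fun x => a * (e' - e) / (2 * √(q x) * (x - e)))
    (fun t => (a * e' - t ^ 2 * e) / (a - t ^ 2))
    (fun t : ℝ => (Polynomial.aeval ((a * e' - t ^ 2 * e) / (a - t ^ 2)) A +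
          Polynomial.aeval ((a * e' - t ^ 2 * e) / (a - t ^ 2)) B *
            (t * ((a * e' - t ^ 2 * e) / (a - t ^ 2) - e))) /
          Polynomial.aeval ((a * e' - t ^ 2 * e) / (a - t ^ 2)) D *
          (2 * sgn * t * ((a * e' - t ^ 2 * e) / (a - t ^ 2) - e) ^ 2 / (|a| * |e' - e|)))
    hφ hφ' hder hne hψ hψφ hF fun p hp => ?_
  -- the Jacobian identity on the slab
  have hx := (hmem p).1 hp
  have h1 := hsq _ hx
  have h2 := hD _ hx
  have h3 := hxe _ hx
  have h4 := habs _ hx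
  rw [hint p hp]
  rw [hψφ _ hx, abs_div, abs_mul, abs_mul, abs_mul, abs_of_pos h1, abs_two, h4,
    div_mul_cancel₀ _ h3]
  field_simp

/-! ## Euler's substitution for no real root: `t = √q + √a x` -/

/-- **Euler's (first) substitution, no real root.** For an arc `[S, (A + B√q)/D]` with
`q = a x² + b x + c`, `a > 0`, `b² < 4ac` (real algebraic coefficients), the substitution
`t = √(q(x)) + √a x` (strictly increasing: `(2ax + b)² < 4aq`; inverse `x = (t² − c)/(b + 2√a t)`,
`√q = t − √a x`) is one rule-(2) move to a real-algebraic rational arc.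
[cite: KontsevichZagier2001, §1.2 rule (2)] -/
theorem euler_noRoot : ∀ (r : KZ.IntegralRep 1) (A B D : Polynomial ℚ) (S : Set ℝ), IsOpen S →
    S.OrdConnected → r.domain = {p | p 0 ∈ S} → ∀ (q : ℝ → ℝ) (a b c : ℝ), IsAlgebraic ℚ a →
    IsAlgebraic ℚ b → IsAlgebraic ℚ c → 0 < a → b ^ 2 < 4 * a * c →
    (∀ x, q x = a * x ^ 2 + b * x + c) → (∀ x ∈ S, 0 < q x) →
    (∀ x ∈ S, (Polynomial.aeval x D : ℝ) ≠ 0) →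
    (∀ p ∈ r.domain, r.integrand p = (Polynomial.aeval (p 0) A +
      Polynomial.aeval (p 0) B * Real.sqrt (q (p 0))) / Polynomial.aeval (p 0) D) →
    ∃ x' ∈ algArcs, KZ.of r - x' ∈ KZ.relationsLE 1 := by
  intro r A B D S hS hSo hdom q a b c ha hb hc ha0 hdisc hq hpos hD hint
  have hmem : ∀ p, p ∈ r.domain ↔ p 0 ∈ S := fun p => by rw [hdom]; rfl
  have hσ := r.isSemialgebraic_domain
  have hsq : ∀ x ∈ S, 0 < √(q x) := fun x hx => Real.sqrt_pos.mpr (hpos x hx)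
  set ρ : ℝ := √a with hρ
  have hρA : IsAlgebraic ℚ ρ := isAlgebraic_sqrt ha
  have hρ0 : 0 < ρ := Real.sqrt_pos.mpr ha0
  have hρ2 : ρ * ρ = a := Real.mul_self_sqrt ha0.le
  -- the key inequality `2ax + b + 2√a√q > 0` (from `(2ax + b)² < 4aq = (2√a√q)²`)
  have hkey : ∀ x ∈ S, 0 < 2 * a * x + b + 2 * ρ * √(q x) := fun x hx => by
    have hs2 : √(q x) * √(q x) = a * x ^ 2 + b * x + c := by
      rw [Real.mul_self_sqrt (hpos x hx).le, hq]
    have h1 : (2 * a * x + b) ^ 2 < (2 * ρ * √(q x)) ^ 2 := by nlinarith [hs2, hρ2, hdisc]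
    have h2 := (abs_lt_of_sq_lt_sq' h1 (by positivity)).1
    linarith
  -- semialgebraicity of `φ = √q + √a x` and `φ' = (2ax + b)/(2√q) + √a` on the slab
  have hx0 : IsSemialgebraicFunOn ℚ r.domain (fun p : Fin 1 → ℝ => p 0) := by
    simpa using isSemialgebraicFunOn_aeval hσ (MvPolynomial.X 0 : MvPolynomial (Fin 1) ℚ)
  have h2A : IsAlgebraic ℚ (2 : ℝ) := by simpa using isAlgebraic_nat (R := ℚ) (A := ℝ) 2
  have haS := isSemialgebraicFunOn_const_of_isAlgebraic hσ ha
  have hbS := isSemialgebraicFunOn_const_of_isAlgebraic hσ hb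
  have hρS := isSemialgebraicFunOn_const_of_isAlgebraic hσ hρA
  have hqsa : IsSemialgebraicFunOn ℚ r.domain (fun p => q (p 0)) :=
    (((haS.fun_mul (hx0.fun_pow 2)).fun_add (hbS.fun_mul hx0)).fun_add
      (isSemialgebraicFunOn_const_of_isAlgebraic hσ hc)).congr fun p _ => (hq (p 0)).symm
  have hφ : IsSemialgebraicFunOn ℚ r.domain (fun p => √(q (p 0)) + ρ * p 0) :=
    hqsa.fun_sqrt.fun_add (hρS.fun_mul hx0)
  have hφ' : IsSemialgebraicFunOn ℚ r.domain
      (fun p => (2 * a * p 0 + b) / (2 * √(q (p 0))) + ρ) :=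
    (((((isSemialgebraicFunOn_const_ofNat hσ 2).fun_mul haS).fun_mul hx0).fun_add hbS).div
      ((isSemialgebraicFunOn_const_ofNat hσ 2).fun_mul hqsa.fun_sqrt)
      fun p hp => mul_ne_zero two_ne_zero (hsq _ ((hmem p).1 hp)).ne').fun_add hρS
  -- the derivative
  have hq' : ∀ x, HasDerivAt q (2 * a * x + b) x := fun x => by
    have e : q = fun y => a * y ^ 2 + b * y + c := funext hq
    rw [e]
    refine ((((hasDerivAt_pow 2 x).const_mul a).add ((hasDerivAt_id' x).const_mul b)).add_const
      c).congr_deriv ?_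
    simp
    ring
  have hder : ∀ x ∈ S, HasDerivAt (fun y => √(q y) + ρ * y)
      ((2 * a * x + b) / (2 * √(q x)) + ρ) x := fun x hx =>
    (((hq' x).sqrt (hpos x hx).ne').add ((hasDerivAt_id' x).const_mul ρ)).congr_deriv
      (by rw [mul_one])
  have hφ'eq : ∀ x ∈ S, (2 * a * x + b) / (2 * √(q x)) + ρ =
      (2 * a * x + b + 2 * ρ * √(q x)) / (2 * √(q x)) := fun x hx => by
    have h1 := (hsq x hx).ne'
    field_simp
  have hne : ∀ x ∈ S, (2 * a * x + b) / (2 * √(q x)) + ρ ≠ 0 := fun x hx => by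
    rw [hφ'eq x hx]
    exact (div_pos (hkey x hx) (mul_pos two_pos (hsq x hx))).ne'
  -- the inverse `ψ t = (t² − c)/(b + 2√a t)`
  have hden : ∀ x ∈ S, b + 2 * ρ * (√(q x) + ρ * x) = 2 * a * x + b + 2 * ρ * √(q x) :=
    fun x _ => by linear_combination (2 * x) * hρ2
  have hψφ : ∀ x ∈ S, ((√(q x) + ρ * x) ^ 2 - c) / (b + 2 * ρ * (√(q x) + ρ * x)) = x := by
    intro x hx
    have hs2 : √(q x) * √(q x) = a * x ^ 2 + b * x + c := by
      rw [Real.mul_self_sqrt (hpos x hx).le, hq]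
    rw [hden x hx, div_eq_iff (hkey x hx).ne']
    linear_combination hs2 + (x ^ 2) * hρ2
  have hψ : ∃ P Q : (algebraicClosure ℚ ℝ)[X], ∀ t ∈ (fun y => √(q y) + ρ * y) '' S,
      (Polynomial.aeval t Q : ℝ) ≠ 0 ∧
      (fun t : ℝ => (t ^ 2 - c) / (b + 2 * ρ * t)) t =
        (Polynomial.aeval t P : ℝ) / (Polynomial.aeval t Q : ℝ) := by
    refine krat_div (krat_sub (krat_pow (krat_id _) 2) (krat_const _ hc))
      (krat_add (krat_const _ hb) (krat_mul (krat_mul (krat_const _ h2A)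
        (krat_const _ hρA)) (krat_id _))) ?_
    rintro _ ⟨x, hx, rfl⟩
    beta_reduce
    rw [hden x hx]
    exact (hkey x hx).ne'
  -- the pushed-forward integrand
  have hDT : ∀ t ∈ (fun y => √(q y) + ρ * y) '' S,
      (Polynomial.aeval ((t ^ 2 - c) / (b + 2 * ρ * t)) D : ℝ) ≠ 0 := by
    rintro _ ⟨x, hx, rfl⟩
    beta_reduce
    rw [hψφ x hx]
    exact hD x hx
  have hbT : ∀ t ∈ (fun y => √(q y) + ρ * y) '' S, b + 2 * ρ * t ≠ 0 := by
    rintro _ ⟨x, hx, rfl⟩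
    beta_reduce
    rw [hden x hx]
    exact (hkey x hx).ne'
  have hF : ∃ P Q : (algebraicClosure ℚ ℝ)[X], ∀ t ∈ (fun y => √(q y) + ρ * y) '' S,
      (Polynomial.aeval t Q : ℝ) ≠ 0 ∧
      (fun t : ℝ => (Polynomial.aeval ((t ^ 2 - c) / (b + 2 * ρ * t)) A +
          Polynomial.aeval ((t ^ 2 - c) / (b + 2 * ρ * t)) B *
            (t - ρ * ((t ^ 2 - c) / (b + 2 * ρ * t)))) /
          Polynomial.aeval ((t ^ 2 - c) / (b + 2 * ρ * t)) D *
          (2 * (t - ρ * ((t ^ 2 - c) / (b + 2 * ρ * t))) / (b + 2 * ρ * t))) t =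
        (Polynomial.aeval t P : ℝ) / (Polynomial.aeval t Q : ℝ) :=
    krat_mul (krat_div (krat_add (krat_aeval A hψ) (krat_mul (krat_aeval B hψ)
      (krat_sub (krat_id _) (krat_mul (krat_const _ hρA) hψ)))) (krat_aeval D hψ) hDT)
      (krat_div (krat_mul (krat_const _ h2A)
        (krat_sub (krat_id _) (krat_mul (krat_const _ hρA) hψ)))
        (krat_add (krat_const _ hb) (krat_mul (krat_mul (krat_const _ h2A)
          (krat_const _ hρA)) (krat_id _))) hbT)
  refine exists_algArc_of_subst r S hS hSo hdom (fun y => √(q y) + ρ * y)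
    (fun x => (2 * a * x + b) / (2 * √(q x)) + ρ)
    (fun t => (t ^ 2 - c) / (b + 2 * ρ * t))
    (fun t : ℝ => (Polynomial.aeval ((t ^ 2 - c) / (b + 2 * ρ * t)) A +
          Polynomial.aeval ((t ^ 2 - c) / (b + 2 * ρ * t)) B *
            (t - ρ * ((t ^ 2 - c) / (b + 2 * ρ * t)))) /
          Polynomial.aeval ((t ^ 2 - c) / (b + 2 * ρ * t)) D *
          (2 * (t - ρ * ((t ^ 2 - c) / (b + 2 * ρ * t))) / (b + 2 * ρ * t)))
    hφ hφ' hder hne hψ hψφ hF fun p hp => ?_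
  -- the Jacobian identity on the slab
  have hx := (hmem p).1 hp
  have h1 := hsq _ hx
  have h2 := hD _ hx
  have h3 := hkey _ hx
  rw [hint p hp]
  rw [hψφ _ hx, hφ'eq _ hx, abs_of_pos (div_pos h3 (mul_pos two_pos h1)), add_sub_cancel_right,
    hden _ hx]
  field_simp

end Euler

end Summit.KontsevichZagierPeriods.AbelContraction.RealHyperellipticSector

end
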